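import Summits.HodgeConjecture.HodgeConjecture.Theorems.F0P3cCMBorelIwahoriDatumU2Inst    -- ★ (U2-B) `F0P3cCMBorelIwahoriDatumU2.exists_cmIwahoriDatum₂` (the `N = 2` CM Iwahori datum package along a given ray)
import Summits.HodgeConjecture.HodgeConjecture.Theorems.F0P3cStCharTSA2Ray                 -- ★ «A2-RAY» `exists_torus_coe_localNonsplitEquiv_eq_diagonal_two` (the ray `d(β, (σ_w β)⁻¹) ∈ T₂(L⁺_v)`)
import Summits.HodgeConjecture.HodgeConjecture.Theorems.R90S5UnitarizableRayEigenvalueBound  -- ★ (N2) ED. 2 `R90.S5.norm_exponent_le_inv_norm_rootDeltaChar` (unitarizable ⇒ `‖χ′(a)‖ ≤ δ^{-1/2}`)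
import Literature.NumberTheory.Automorphic.ReductionTheoryGLnConjugation                   -- ★ `isClosed_upperUnitriangular` (for `hN`)
import HarnessLib

/-!
# R90-TF · S5 «Ch. 13.3» — brick (N3c) of S5-C's socket road: THE `N = 2` IWAHORI DATUM OF `B₂ ≤ U(Φ₂)(L⁺_v)` ALONG THE RAY `d(α, (σ_w α)⁻¹)`, packaged in
# (N2)'s binder currency `(t := cmBorelTriple L 2 v) (𝓘) (hN) (haN) (haNbar) (hexh)`, and the ray-pinned unitary exponent bound it unlocks
# (`Theorems/R90S5CMIwahoriDatumTwo.lean`; Casselman 1995 Prop. 1.4.4, §4.4; Rogawski 1990 §12.1 p. 171, §13.1 p. 199 ¶3)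

Cell `hodgecm-mathlib`, crux H413 (`stmt-HodgeConjecture-24833`), route of record `HCCMUnconditional`; programme R90-TF, section S5 (base `R90-C133`), seat R90-C133-p03 (g4);
S5 dealer R90-C133-plan (g4) FIRST WORD (4) DEAL (N3c) (R90 bus 2026-09-05T04:05:59Z).  PROOF lane (`--supports stmt-HodgeConjecture-24833 --as helper`): theorems only;
no `def`, no instance, no notation, no `sorry`; Lines-free.

THE ROAD (dealer (4)).  S5-C's own closable socket is `stub_R90_S5_excPS_notUnitarizable : ExcPSNotUnitarizableLetter` (`Cruxes/H413/Lines/R90_S5_HSideExportC.lean` :487;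
[Rogawski1990, §13.1 p. 199 ¶3, Thm. 13.1.1 (2); §12.1 p. 171]): no constituent of the excluded principal series of `H_v = U(Φ₂)_v × U(Φ₁)_v` is unitarizable.  Its payer =
(N1) irreducibility of `i_{U(Φ₂)}(χ)` off Keys' points + (N2) ★ `R90S5UnitarizableRayEigenvalueBound` (unitarizable ⇒ every Jacquet exponent has `‖χ′(a)‖ ≤ δ_B(a)^{-1/2}`
along a contracting ray, GIVEN an Iwahori datum `𝓘` of `t` with ★ R2's three ray hypotheses) + (N3b) the two exponents of `i_{U(Φ₂)}(χ)` + (N3c) = THIS FILE: the datum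
at `N = 2`, so that (N2)'s head has NO Iwahori binder left.  Nothing is ported: road (D) «DEEP-FL» typed the `N = 2` bricks already — (U2-A) ★ `F0P3cIwahoriDatumU2`
(model datum, dominance package, `hinj`), (U2-B) ★ `F0P3cCMBorelIwahoriDatumU2(Inst)` (transport to `cmBorelTriple L 2 v`, hypothesis-free along a given ray `a₂`),
«A2-RAY» ★ `F0P3cStCharTSA2Ray` (the ray exists in `T₂(L⁺_v)` for every `β ≠ 0`).  This file instantiates them in (N2)'s currency:
* §1 `isClosed_cmBorelTriple_two_N` — (N2)'s `hN` (★ `isClosed_upperUnitriangular`, the idiom of ★ `F0P3cStCharTSCassHTrace` :180).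
* §2 `exists_cmIwahoriDatum_two` — at a non-split `v` (`w ∣ v`, `c̄ • w = w`), for every `α ∈ L_w` with `0 < |α|_w < 1`: `∃ 𝓘 : (cmBorelTriple L 2 v).IwahoriDatum` whose ray
  `𝓘.a` has model matrix `d(α, (σ_w α)⁻¹)` (PINNED, so the assembler evaluates `δ_B` and the exponents there) with `haN`, `haNbar`, `hexh` = (N2) ED. 2 :187's binder texts
  at `t := cmBorelTriple L 2 v` TOKEN FOR TOKEN; `exists_cmIwahoriDatum_two_uniformizer` — the same along a uniformiser `ϖ` (`Valued.v ϖ = exp (−1)`), hypothesis-free.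
* §3 `norm_exponent_le_of_isUnitarizable_two` — the (N2)-junction: for an admissible unitarizable `ρ` of `U(Φ₂)(L⁺_v)` and a Jacquet exponent `χ′` along `B₂`
  (★ `Representation.HasJacquetExponent ρ (cmBorelTriple L 2 v) χ′`), at the datum of §2: `‖χ′(𝓘.a)‖ ≤ ‖δ_B^{1/2}(𝓘.a)‖⁻¹` — ★ (N2) `norm_exponent_le_inv_norm_rootDeltaChar`
  fed §1 + §2 (`[LocallyCompactSpace ↥t.P]` by ★ `locallyCompactSpace_cmBorelU L 2 v`): the ray-pinned bound with ZERO Iwahori binders, the shape (N3)'s contradiction consumes.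
HONEST LABEL: plumbing; pays no socket by itself (the content of C :487's road is (N1) + the value `δ_B(d(α,(σα)⁻¹))` vs the excluded exponent); REL ≠ ★ ≠ BUILT; HC_CM is proved
only modulo the 7 printed citations (2 remaining named inputs: hLiu418 = stmt-HodgeConjecture-24832, h413 = stmt-HodgeConjecture-24833) until rung 0 closes.
[cite: Casselman1995, Prop. 1.4.4 p. 14; §4.4 p. 45, Thm. 4.4.6] [cite: Rogawski1990, §1.10 p. 9; §4.4 p. 46; §12.1 p. 171; §13.1 p. 199] [cite: PlatonovRapinchuk1994, §5.1]
-/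

set_option autoImplicit false
-- the mandated namespace repeats the single-problem summit's segment (`HodgeConjecture.HodgeConjecture`)
set_option linter.dupNamespace false

noncomputable section

open scoped MatrixGroups Pointwise WithZero
open ValuativeRel Matrix
open Literature.NumberTheory Literature.NumberTheory.Automorphic Literature.NumberTheory.Automorphic.UnitaryGroup
open _root_.NumberField _root_.IsDedekindDomain

namespace Summit.HodgeConjecture.HodgeConjecture.R90.S5

open Summit.HodgeConjecture.HodgeConjecture.Cruxes.H413
open Summit.HodgeConjecture.HodgeConjecture.Cruxes.H413.F0P3cCMBorelIwahoriDatumU2 (exists_cmIwahoriDatum₂)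
open Summit.HodgeConjecture.HodgeConjecture.Cruxes.H413.F0P3cStCharTSA2Ray (exists_torus_coe_localNonsplitEquiv_eq_diagonal_two)

variable (L : Type) [Field L] [NumberField L] [IsCMField L] (v : HeightOneSpectrum (𝓞 ↥(maximalRealSubfield L)))

/-! ## §1 (N2)'s `hN`: the unipotent radical of `B₂` is closed -/

/-- **`N₂ ≤ U(Φ₂)(L⁺_v)` is closed** (upper unitriangular matrices are cut out by closed equations in a `T₁` ring; pulled back along the subtype inclusion) — the `hN` binder of ★
(N2) `norm_exponent_le_inv_norm_rootDeltaChar` at `t := cmBorelTriple L 2 v`. [cite: Rogawski1990, §12.2 p. 173] -/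
theorem isClosed_cmBorelTriple_two_N :
    IsClosed (((cmBorelTriple L 2 v).N : Subgroup ↥(unitaryGroupOfForm (conjLocal L (IsCMField.complexConj L) v) (cmLocalForm L 2 v))) :
      Set ↥(unitaryGroupOfForm (conjLocal L (IsCMField.complexConj L) v) (cmLocalForm L 2 v))) :=
  (isClosed_upperUnitriangular (n := 2) (R := UnitaryGroup.LocalRing L v)).preimage continuous_subtype_val

/-! ## §2 The `N = 2` Iwahori datum along the ray `d(α, (σ_w α)⁻¹)`, in (N2)'s binder currency -/

variable (w : PlacesOver L v) (hw : IsCMField.complexConj L • w.1 = w.1)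

/-- **(N3c) `exists_cmIwahoriDatum_two` — THE IWAHORI DATUM OF `B₂ ≤ U(Φ₂)(L⁺_v)` ALONG A CONTRACTING RAY, (N2)'s CURRENCY.**  At a non-split `v` (`w ∣ v`, `c̄ • w = w`),
for every `α ∈ L_w` with `α ≠ 0`, `|α|_w < 1`: there is an Iwahori datum `𝓘` of ★ `cmBorelTriple L 2 v` whose ray `𝓘.a ∈ T₂` has one-place model matrix `d(α, (σ_w α)⁻¹)`
and which satisfies ★ R2's three ray hypotheses — `haN` (`a` contracts `K_n ∩ N` into `K_n`), `haNbar` (`a⁻¹` keeps `K_n ∩ N̄` inside itself), `hexh` (every `n ∈ N` is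
eventually conjugated into `K_n`) — the binder texts of ★ (N2) ED. 2 :187 at `t := cmBorelTriple L 2 v`, token for token.  Proof: «A2-RAY» ★
`exists_torus_coe_localNonsplitEquiv_eq_diagonal_two` gives `a₂ ∈ T₂` with that model; (U2-B) ★ `exists_cmIwahoriDatum₂` gives the package with `𝓘.a = a₂` (clauses 1, 7, 8, 9 kept).
[cite: Casselman1995, Prop. 1.4.4 p. 14] [cite: Rogawski1990, §1.10 p. 9; §4.4 p. 46] [cite: PlatonovRapinchuk1994, §5.1] -/
theorem exists_cmIwahoriDatum_two {α : w.1.adicCompletion L} (hα0 : α ≠ 0) (hα1 : Valued.v α < 1) :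
    ∃ 𝓘 : (cmBorelTriple L 2 v).IwahoriDatum,
      (((localNonsplitEquiv (IsCMField.complexConj L) (Matrix.of fun i j : Fin 2 => if i.val + j.val + 1 = 2 then (1 : L) else 0)
          (IsCMField.complexConj_ne_one L) w hw 𝓘.a :
            ↥(unitaryGroupOfForm (galAdicCompletionMap (L := L) (IsCMField.complexConj L) hw)
              (placeForm (Matrix.of fun i j : Fin 2 => if i.val + j.val + 1 = 2 then (1 : L) else 0) w.1))) :
            GL (Fin 2) (w.1.adicCompletion L)) : Matrix (Fin 2) (Fin 2) (w.1.adicCompletion L)) =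
        Matrix.diagonal ![α, ((galAdicCompletionMap (L := L) (IsCMField.complexConj L) hw) α)⁻¹] ∧
      (∀ n, ∀ x ∈ 𝓘.K n ⊓ (cmBorelTriple L 2 v).N, 𝓘.a * x * 𝓘.a⁻¹ ∈ 𝓘.K n) ∧
      (∀ n, ∀ x ∈ 𝓘.K n ⊓ 𝓘.Nbar, 𝓘.a⁻¹ * x * 𝓘.a ∈ 𝓘.K n ⊓ 𝓘.Nbar) ∧
      (∀ n, ∀ x ∈ (cmBorelTriple L 2 v).N, ∃ m : ℕ, ∀ m', m ≤ m' → 𝓘.a ^ m' * x * (𝓘.a ^ m')⁻¹ ∈ 𝓘.K n) := by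
  obtain ⟨b, hb⟩ := exists_torus_coe_localNonsplitEquiv_eq_diagonal_two L v w hw hα0
  obtain ⟨𝓘, K₀, ha, -, -, -, -, -, haN, haNbar, hexh, -⟩ := exists_cmIwahoriDatum₂ L v w hw (b : ↥(unitaryGroupOfForm (conjLocal L (IsCMField.complexConj L) v) (cmLocalForm L 2 v))) hα0 hα1 hb
  refine ⟨𝓘, ?_, haN, haNbar, hexh⟩
  rw [ha]
  exact hb

/-- **The same along a UNIFORMISER, hypothesis-free at every non-split place**: there are `ϖ ∈ L_w` with `Valued.v ϖ = exp (−1)` (Mathlib ★ `valuation_exists_uniformizer`) and an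
Iwahori datum of `cmBorelTriple L 2 v` along `d(ϖ, (σ_w ϖ)⁻¹)` with `haN`, `haNbar`, `hexh`. [cite: Casselman1995, Prop. 1.4.4 p. 14] [cite: Rogawski1990, §12.1 p. 171] -/
theorem exists_cmIwahoriDatum_two_uniformizer :
    ∃ (ϖ : w.1.adicCompletion L) (𝓘 : (cmBorelTriple L 2 v).IwahoriDatum), Valued.v ϖ = WithZero.exp (-1 : ℤ) ∧
      (((localNonsplitEquiv (IsCMField.complexConj L) (Matrix.of fun i j : Fin 2 => if i.val + j.val + 1 = 2 then (1 : L) else 0)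
          (IsCMField.complexConj_ne_one L) w hw 𝓘.a :
            ↥(unitaryGroupOfForm (galAdicCompletionMap (L := L) (IsCMField.complexConj L) hw)
              (placeForm (Matrix.of fun i j : Fin 2 => if i.val + j.val + 1 = 2 then (1 : L) else 0) w.1))) :
            GL (Fin 2) (w.1.adicCompletion L)) : Matrix (Fin 2) (Fin 2) (w.1.adicCompletion L)) =
        Matrix.diagonal ![ϖ, ((galAdicCompletionMap (L := L) (IsCMField.complexConj L) hw) ϖ)⁻¹] ∧
      (∀ n, ∀ x ∈ 𝓘.K n ⊓ (cmBorelTriple L 2 v).N, 𝓘.a * x * 𝓘.a⁻¹ ∈ 𝓘.K n) ∧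
      (∀ n, ∀ x ∈ 𝓘.K n ⊓ 𝓘.Nbar, 𝓘.a⁻¹ * x * 𝓘.a ∈ 𝓘.K n ⊓ 𝓘.Nbar) ∧
      (∀ n, ∀ x ∈ (cmBorelTriple L 2 v).N, ∃ m : ℕ, ∀ m', m ≤ m' → 𝓘.a ^ m' * x * (𝓘.a ^ m')⁻¹ ∈ 𝓘.K n) := by
  obtain ⟨π, hπ⟩ := IsDedekindDomain.HeightOneSpectrum.valuation_exists_uniformizer L w.1
  have hϖ : Valued.v ((π : L) : w.1.adicCompletion L) = WithZero.exp (-1 : ℤ) := by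
    rw [IsDedekindDomain.HeightOneSpectrum.valuedAdicCompletion_eq_valuation']; exact hπ
  have hϖ0 : ((π : L) : w.1.adicCompletion L) ≠ 0 := fun h0 => by
    rw [h0, map_zero] at hϖ
    exact WithZero.zero_ne_coe hϖ
  have hϖ1 : Valued.v ((π : L) : w.1.adicCompletion L) < 1 := by
    rw [hϖ, ← WithZero.exp_zero]
    exact WithZero.exp_lt_exp.2 (by norm_num)
  obtain ⟨𝓘, h𝓘⟩ := exists_cmIwahoriDatum_two L v w hw hϖ0 hϖ1
  exact ⟨_, 𝓘, hϖ, h𝓘⟩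

/-! ## §3 The (N2)-junction: the ray-pinned unitary exponent bound on `U(Φ₂)(L⁺_v)`, no Iwahori binder left -/

/-- **UNITARIZABLE ⇒ `‖χ′(a)‖ ≤ δ_B(a)^{-1/2}` AT THE RAY `a = d(α, (σ_w α)⁻¹)` OF `B₂ ≤ U(Φ₂)(L⁺_v)`** — ★ (N2) `norm_exponent_le_inv_norm_rootDeltaChar` at `t := cmBorelTriple L 2 v`
with its `(𝓘) (hN) (haN) (haNbar) (hexh)` binders DISCHARGED by §1–§2 (`[LocallyCompactSpace ↥t.P]` := ★ `locallyCompactSpace_cmBorelU L 2 v`): for every admissible unitarizable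
smooth representation `ρ` of `U(Φ₂)(L⁺_v)` and every Jacquet exponent `χ′` of `ρ` along `B₂`, there is an Iwahori datum `𝓘` with ray of model `d(α, (σ_w α)⁻¹)` such that
`‖χ′(𝓘.a)‖ ≤ ‖δ_B^{1/2}(𝓘.a)‖⁻¹`.  The shape (N3)'s contradiction consumes against (N3b)'s exponents of the excluded principal series.
[cite: Casselman1995, §4.4 p. 45, Thm. 4.4.6] [cite: Rogawski1990, §12.1 p. 171; §13.1 p. 199] -/
theorem norm_exponent_le_of_isUnitarizable_two {α : w.1.adicCompletion L} (hα0 : α ≠ 0) (hα1 : Valued.v α < 1)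
    {V : Type*} [AddCommGroup V] [Module ℂ V]
    {ρ : Representation ℂ ↥(unitaryGroupOfForm (conjLocal L (IsCMField.complexConj L) v) (cmLocalForm L 2 v)) V}
    (hu : ρ.IsUnitarizable) (hρa : ρ.IsAdmissible) :
    haveI := locallyCompactSpace_cmBorelU L 2 v
    ∀ {χ' : ↥(cmBorelTriple L 2 v).M →* ℂˣ}, ρ.HasJacquetExponent (cmBorelTriple L 2 v) χ' →
    ∃ 𝓘 : (cmBorelTriple L 2 v).IwahoriDatum,
      (((localNonsplitEquiv (IsCMField.complexConj L) (Matrix.of fun i j : Fin 2 => if i.val + j.val + 1 = 2 then (1 : L) else 0)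
          (IsCMField.complexConj_ne_one L) w hw 𝓘.a :
            ↥(unitaryGroupOfForm (galAdicCompletionMap (L := L) (IsCMField.complexConj L) hw)
              (placeForm (Matrix.of fun i j : Fin 2 => if i.val + j.val + 1 = 2 then (1 : L) else 0) w.1))) :
            GL (Fin 2) (w.1.adicCompletion L)) : Matrix (Fin 2) (Fin 2) (w.1.adicCompletion L)) =
        Matrix.diagonal ![α, ((galAdicCompletionMap (L := L) (IsCMField.complexConj L) hw) α)⁻¹] ∧
      ‖((χ' ⟨𝓘.a, 𝓘.a_mem⟩ : ℂˣ) : ℂ)‖ ≤ ‖((rootDeltaChar (cmBorelTriple L 2 v).P ⟨𝓘.a, (cmBorelTriple L 2 v).M_le 𝓘.a_mem⟩ : ℂˣ) : ℂ)‖⁻¹ := by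
  haveI := locallyCompactSpace_cmBorelU L 2 v
  intro χ' hχ
  obtain ⟨𝓘, ha, haN, haNbar, hexh⟩ := exists_cmIwahoriDatum_two L v w hw hα0 hα1
  exact ⟨𝓘, ha, norm_exponent_le_inv_norm_rootDeltaChar (cmBorelTriple L 2 v) 𝓘 (isClosed_cmBorelTriple_two_N L v) hu hρa haN haNbar hexh hχ⟩

end Summit.HodgeConjecture.HodgeConjecture.R90.S5

end
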